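import Summits.FinalStateConjecture.FinalStateConjecture.Theorems.HawkingExtensionIsKerr.Negative.ExtremalKerrNoCollar

/-!
# `HawkingExtensionIsKerr` (crux `stmt-FinalStateConjecture-17840`): the collar pins the horizon
# generator — `g(T + cΦ, T + cΦ) = σ (c(r₊² + a²) − a)² / ρ² ≥ 0` ON the horizon, so only `c = ω₊`
# can carry a Killing–timelike collar, and at `a = M` no `c` does

Negative-lane tightness lemma II for the crux `HawkingExtensionIsKerr` (cdisprove seat, cycle 1),
continuing `ExtremalKerrNoCollar.lean`.  The crux's collar data are an open `U ⊇ 𝓔⁺` and a Killing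
field `K` on `U`, tangent and non-vanishing on `𝓔⁺`, commuting with `T`, TIMELIKE on `U ∩ doc`.  On a
Kerr exterior the candidates are the constant combinations `T + cΦ` (and `βΦ`, spacelike); this file
computes their norm ON the horizon `{r = r₊}` of the Kerr–Schild chart for all `|a| ≤ M`, `M > 0`:

  `g(T + cΦ, T + cΦ)|_{r = r₊} = σ · (c (r₊² + a²) − a)² / ρ²`,  `σ = sin²θ = (r₊² − x₃²)/r₊²`,
  `ρ² = r₊² + a²(1 − σ)`                                  (`bilin_stationary_add_smul_axial_on_horizon`),

non-negative, and POSITIVE off the axis unless `c = a/(r₊² + a²) = ω₊`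
(`bilin_stationary_add_smul_axial_on_horizon_pos`).  Hence (`not_exists_collar_of_ne_horizonAngularVelocity`)
for `c ≠ ω₊` there is NO `ε₀ > 0` with `g(T + cΦ, T + cΦ) < 0` on the coordinate collar
`r₊ < r < r₊ + ε₀` (equatorial points just outside the horizon are spacelike, by continuity in `r`),
for every `|a| ≤ M`: the collar clause forces `K ∝ T + ω₊Φ`, the null generator of `𝓔⁺`.  Combined
with `not_exists_collar_hawkingVector_extremal` (`c = ω₊ = 1/(2M)` fails at `a = M`):
**at `a = M` no field `T + cΦ`, `c ∈ ℝ`, has a Killing–timelike collar**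
(`not_exists_collar_extremal`), while for `|a| < M` exactly one does (DRSR Lemma 4.7.2, tree
`Kerr.exists_bilin_hawkingVector_neg`).  This is the precise sense in which the crux's hypothesis
`∀ x ∈ U ∩ doc, g(K,K) < 0` excludes the degenerate horizon, for which the conclusion `|a| < M` fails.

References: Dafermos–Rodnianski–Shlapentokh-Rothman, arXiv:1402.7034, §2.2.2, Lemma 4.7.1–4.7.2;
B. O'Neill, *The geometry of Kerr black holes* (1995), §2.4–§2.5 (horizon, `ω₊`).
-/

noncomputable section

namespace Summit.FinalStateConjecture.FinalStateConjecture.Theorems.HawkingExtensionIsKerr.Negative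

open Literature.Geometry.Lorentzian Literature.Geometry.Lorentzian.Kerr

/-- `r₊ > 0` for `|a| ≤ M`, `M > 0` (local copy; `Kerr.rPlus_pos` lives in `KerrSurfaceGravity`). [folklore] -/
private theorem rPlus_pos_of {M a : ℝ} (hM : 0 < M) : 0 < rPlus M a := by
  unfold rPlus
  have := Real.sqrt_nonneg (M ^ 2 - a ^ 2)
  linarith

/-- `ω₊ = a/(r₊² + a²)` for `|a| ≤ M`, `M > 0` (`r₊² + a² = 2Mr₊`). [cite: DafermosRodnianskiShlapentokhrothman2014, §2.2.2] -/
theorem horizonAngularVelocity_eq_div_sq {M a : ℝ} (h : |a| ≤ M) :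
    horizonAngularVelocity M a = a / (rPlus M a ^ 2 + a ^ 2) := by
  unfold horizonAngularVelocity
  rw [rPlus_sq_add_sq h]

/-- **`g(T + cΦ, T + cΦ)` ON the horizon**: at a point of the Kerr–Schild chart with `r = r₊`
(`|a| ≤ M`, `M > 0`), `g(T + cΦ, T + cΦ) = σ (c(r₊² + a²) − a)²/ρ²` with `σ = (r₊² − x₃²)/r₊²`,
`ρ² = r₊² + a²(1 − σ)`: the induced form on `span{T, Φ}` is degenerate there, with null direction
`T + ω₊Φ`. [cite: DafermosRodnianskiShlapentokhrothman2014, Lemma 4.7.1] -/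
theorem bilin_stationary_add_smul_axial_on_horizon {M a : ℝ} (h : |a| ≤ M) (hM : 0 < M) (c : ℝ)
    {x : E4} (hx : radius a x = rPlus M a) :
    bilin M a x (E4.basisVector 0 + c • axialVector x) (E4.basisVector 0 + c • axialVector x) =
      (rPlus M a ^ 2 - x 3 ^ 2) / rPlus M a ^ 2 * (c * (rPlus M a ^ 2 + a ^ 2) - a) ^ 2 /
        (rPlus M a ^ 2 + a ^ 2 * (1 - (rPlus M a ^ 2 - x 3 ^ 2) / rPlus M a ^ 2)) := by
  have hr : 0 < rPlus M a := rPlus_pos_of hM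
  have hrx : 0 < radius a x := hx ▸ hr
  rw [bilin_basisVector_add_smul_axialVector M a c hrx, hx, ← rPlus_sq_add_sq h]
  have hr0 : rPlus M a ≠ 0 := hr.ne'
  -- treat `σ = (r₊² − x₃²)/r₊²` as an atom; the only denominator left is `ρ² = r₊² + a²(1 − σ)`
  set σ := (rPlus M a ^ 2 - x 3 ^ 2) / rPlus M a ^ 2 with hσ
  have hσ1 : 0 ≤ 1 - σ := by
    rw [hσ, sub_div, div_self (pow_ne_zero 2 hr0)]
    have : 0 ≤ x 3 ^ 2 / rPlus M a ^ 2 := by positivity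
    linarith
  have hρ : rPlus M a ^ 2 + a ^ 2 * (1 - σ) ≠ 0 := by positivity
  field_simp
  ring

/-- On the horizon `g(T + cΦ, T + cΦ) ≥ 0`. [folklore] -/
theorem bilin_stationary_add_smul_axial_on_horizon_nonneg {M a : ℝ} (h : |a| ≤ M) (hM : 0 < M)
    (c : ℝ) {x : E4} (hx : radius a x = rPlus M a) :
    0 ≤ bilin M a x (E4.basisVector 0 + c • axialVector x) (E4.basisVector 0 + c • axialVector x) := by
  have hr : 0 < rPlus M a := rPlus_pos_of hM
  have hx3 : x 3 ^ 2 ≤ rPlus M a ^ 2 := hx ▸ sq_apply_three_le_radius_sq a (hx ▸ hr)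
  rw [bilin_stationary_add_smul_axial_on_horizon h hM c hx]
  have h1 : 0 ≤ 1 - (rPlus M a ^ 2 - x 3 ^ 2) / rPlus M a ^ 2 := by
    rw [sub_div, div_self (pow_ne_zero 2 hr.ne')]
    have : 0 ≤ x 3 ^ 2 / rPlus M a ^ 2 := by positivity
    linarith
  have h2 : 0 ≤ rPlus M a ^ 2 - x 3 ^ 2 := by linarith
  positivity

/-- **Off the axis, `T + cΦ` is SPACELIKE on the horizon unless `c = ω₊`.** [folklore] -/
theorem bilin_stationary_add_smul_axial_on_horizon_pos {M a : ℝ} (h : |a| ≤ M) (hM : 0 < M)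
    {c : ℝ} (hc : c ≠ horizonAngularVelocity M a) {x : E4} (hx : radius a x = rPlus M a)
    (hx3 : x 3 ^ 2 < rPlus M a ^ 2) :
    0 < bilin M a x (E4.basisVector 0 + c • axialVector x) (E4.basisVector 0 + c • axialVector x) := by
  have hr : 0 < rPlus M a := rPlus_pos_of hM
  rw [bilin_stationary_add_smul_axial_on_horizon h hM c hx]
  have hA : 0 < rPlus M a ^ 2 + a ^ 2 := by positivity
  have hca : c * (rPlus M a ^ 2 + a ^ 2) - a ≠ 0 := by
    intro h0
    apply hc
    rw [horizonAngularVelocity_eq_div_sq h, eq_div_iff hA.ne']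
    linarith
  have h1 : 0 < (c * (rPlus M a ^ 2 + a ^ 2) - a) ^ 2 :=
    lt_of_le_of_ne (sq_nonneg _) (Ne.symm (pow_ne_zero 2 hca))
  have h2 : 0 < rPlus M a ^ 2 - x 3 ^ 2 := by linarith
  have h3 : 0 ≤ 1 - (rPlus M a ^ 2 - x 3 ^ 2) / rPlus M a ^ 2 := by
    rw [sub_div, div_self (pow_ne_zero 2 hr.ne')]
    have : 0 ≤ x 3 ^ 2 / rPlus M a ^ 2 := by positivity
    linarith
  positivity

/-- `g(T + cΦ, T + cΦ)` at the equatorial point of radius `r > 0` is the one-variable function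
`−1 + c²(r² + a²) + (2M/r)(1 − ca)²`. [folklore] -/
theorem bilin_stationary_add_smul_axial_equatorial (M a c : ℝ) {r : ℝ} (hr : 0 < r) :
    bilin M a (E4.ofTimeSpace 0 (EuclideanSpace.single 0 (√(r ^ 2 + a ^ 2))))
        (E4.basisVector 0 + c • axialVector (E4.ofTimeSpace 0 (EuclideanSpace.single 0 (√(r ^ 2 + a ^ 2)))))
        (E4.basisVector 0 + c • axialVector (E4.ofTimeSpace 0 (EuclideanSpace.single 0 (√(r ^ 2 + a ^ 2))))) =
      -1 + c ^ 2 * (r ^ 2 + a ^ 2) + 2 * M / r * (1 - c * a) ^ 2 := by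
  have hrad := radius_equatorialPoint_sqrt a hr.le
  have hx3 := equatorialPoint_apply_three (√(r ^ 2 + a ^ 2))
  rw [bilin_basisVector_add_smul_axialVector M a c (by rw [hrad]; exact hr), hrad, hx3]
  have hr0 : r ≠ 0 := hr.ne'
  field_simp
  ring

/-- **Only the horizon generator can carry a Killing–timelike collar**: for `|a| ≤ M`, `M > 0` and
`c ≠ ω₊` there is NO `ε₀ > 0` with `g(T + cΦ, T + cΦ) < 0` on `r₊ < r < r₊ + ε₀` — equatorial points
just outside the horizon are spacelike (the equatorial value at `r₊` is `(c(r₊² + a²) − a)²/r₊² > 0`,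
continuity in `r`). [cite: DafermosRodnianskiShlapentokhrothman2014, Lemma 4.7.2] -/
theorem not_exists_collar_of_ne_horizonAngularVelocity {M a c : ℝ} (h : |a| ≤ M) (hM : 0 < M)
    (hc : c ≠ horizonAngularVelocity M a) :
    ¬ ∃ ε₀ : ℝ, 0 < ε₀ ∧ ∀ x : E4, rPlus M a < radius a x → radius a x < rPlus M a + ε₀ →
        bilin M a x (E4.basisVector 0 + c • axialVector x) (E4.basisVector 0 + c • axialVector x) < 0 := by
  rintro ⟨ε₀, hε, hneg⟩
  have hr : 0 < rPlus M a := rPlus_pos_of hM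
  -- the equatorial value at the horizon is positive
  have hpos : 0 < -1 + c ^ 2 * (rPlus M a ^ 2 + a ^ 2) + 2 * M / rPlus M a * (1 - c * a) ^ 2 := by
    rw [← bilin_stationary_add_smul_axial_equatorial M a c hr]
    have hx3sq : (E4.ofTimeSpace 0 (EuclideanSpace.single 0 (√(rPlus M a ^ 2 + a ^ 2)))) 3 ^ 2 <
        rPlus M a ^ 2 := by
      rw [equatorialPoint_apply_three, zero_pow two_ne_zero]
      positivity
    exact bilin_stationary_add_smul_axial_on_horizon_pos h hM hc
      (radius_equatorialPoint_sqrt a hr.le) hx3sq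
  -- continuity in `r` at `r₊`
  have hcont : ContinuousAt (fun r : ℝ ↦ -1 + c ^ 2 * (r ^ 2 + a ^ 2) + 2 * M / r * (1 - c * a) ^ 2)
      (rPlus M a) := by
    have hr0 : rPlus M a ≠ 0 := hr.ne'
    fun_prop (disch := exact hr0)
  have hev := hcont.eventually (lt_mem_nhds hpos)
  obtain ⟨η, hη, hball⟩ := Metric.eventually_nhds_iff.1 hev
  -- an equatorial point of radius `r₊ + δ`, `δ = min η ε₀ / 2`
  set δ := min η ε₀ / 2 with hδ
  have hδpos : 0 < δ := by rw [hδ]; positivity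
  have hδη : δ < η := by
    rw [hδ]; linarith [min_le_left η ε₀]
  have hδε : δ < ε₀ := by
    rw [hδ]; linarith [min_le_right η ε₀]
  have hr' : 0 < rPlus M a + δ := by linarith
  have hrad := radius_equatorialPoint_sqrt a hr'.le
  have hlt := hneg (E4.ofTimeSpace 0 (EuclideanSpace.single 0 (√((rPlus M a + δ) ^ 2 + a ^ 2))))
    (by rw [hrad]; linarith) (by rw [hrad]; linarith)
  rw [bilin_stationary_add_smul_axial_equatorial M a c hr'] at hlt
  have hgt := hball (y := rPlus M a + δ)
    (by rw [Real.dist_eq, show rPlus M a + δ - rPlus M a = δ by ring, abs_of_pos hδpos]; exact hδη)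
  linarith

/-- **At `a = M` NO field `T + cΦ` has a Killing–timelike collar** (`c ≠ ω₊` by the horizon
computation, `c = ω₊` by `not_exists_collar_hawkingVector_extremal`), whereas for `|a| < M` the
Hawking field does (tree `Kerr.exists_bilin_hawkingVector_neg`): the collar hypothesis of
`HawkingExtensionIsKerr` separates exactly the sub-extremal from the extremal Kerr exterior. [folklore] -/
theorem not_exists_collar_extremal {M : ℝ} (hM : 0 < M) (c : ℝ) :
    ¬ ∃ ε₀ : ℝ, 0 < ε₀ ∧ ∀ x : E4, rPlus M M < radius M x → radius M x < rPlus M M + ε₀ →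
        bilin M M x (E4.basisVector 0 + c • axialVector x) (E4.basisVector 0 + c • axialVector x) < 0 := by
  by_cases hc : c = horizonAngularVelocity M M
  · subst hc
    exact not_exists_collar_hawkingVector_extremal hM
  · exact not_exists_collar_of_ne_horizonAngularVelocity (le_of_eq (abs_of_pos hM)) hM hc

end Summit.FinalStateConjecture.FinalStateConjecture.Theorems.HawkingExtensionIsKerr.Negative

end
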